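import Summits.CriticalPhenomena.PercolationContinuityZ3.Theorems.PercAnnulusCrossingSlabMSFLanding
import HarnessLib

/-!
# RSW3 lane (lead, gen 45): NTW 2017 §4 — THE LANDING DATA, II: the plus-entry vertex `w` of Step 2 and the blocked-absorption
# instances at the scale (file F5, second part, of the build-out of Theorem 2.4)

builds on p205010 (kernel theorem, internal audit signed; external expert review pending) — NOT used in this file.

Cell `prim-rsw3`, lead seat (gen 45), blueprint `prim-rsw3-lead/gen44/BUILDOUT-PLAN.md` §2 (e), (f).  Support file
(`--supports stmt-CriticalPhenomena-4575`); no definitions, no named facts, no sorries.  Continuation of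
`PercAnnulusCrossingSlabMSFLanding.lean` (break-out facts, `z(ω)` = `zHat`, its locality); vocabulary as there
(`wDom k Γ z M = Λ_M ∖ B̄₁^#(z′)`, `wHat k Γ z M U b` = NTW's `w`, `Λ_M = ballFinset k 0 M`, `M = m_i - 1`).

Newman–Tassion–Wu (arXiv:1512.09107, §4.1, proof of Lemma 4.1, p. 21): «If `𝓘_x^{m_i}` touches `B̄₁^#(z′)` … define
`τ_i^x = min{j : 𝓘_x[j] ∈ ∂B̄₁^#(z′)}` and `w = 𝓘_x[τ_i]` to be the first vertex in `∂B̄₁^#(z′)` reached by the invasion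
cluster starting from `x`» and «note that when `D_{2n_i,m_i}` occurs, `𝓘_0^{m_i}` (or `𝓘_x^{m_i}`) touching any vertex
`v ∈ B̄_{2n_i}(0)` implies it also contains all of `C_{p_c}(v)`».  Here:

* **`wHat_spec`**: on `𝓑_b` (every vertex of `Γ` in `𝓘_b^M`) the invasion of `b` enters the plus cylinder strictly BEFORE it
  leaves `Λ_M`, at the vertex `w`, which lies in an ARM column of `z′` (`planarAdj (planar w) z′`), is invaded at that time, and
  everything invaded up to then is in `Λ_M`; `wHat_congr` — LOCALITY of `w` under relabelling off the plus pairs;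
* BLOCKED ABSORPTION at the scale (repairs (R0)/(R1) of the lane's memo `SEQUEL-MSF.md` §3): on
  `D′ = {η ∉ B_{N+1} ⟷^{B_{M+1}} ∂B_{M+1}}`, `N + 1 ≤ M`, the `p`-cluster of a vertex over `B_{N+1}` lies in `Λ_M`
  (`openCluster_subset_ballFinset_of_not_mem_slabConn`, first-exit argument), hence inside the stopped invasion `𝓘_b^M` once the
  vertex is (`openCluster_subset_stoppedInvasion`, by the lane's `Rsw3.openCluster_subset_invasion_exitIndex`); the gluing
  read-out `forall_mem_stoppedInvasion_of_reachable` (`V(Γ) ⊆ 𝓘_b^M` from ONE vertex of `𝓘_b^M` over `B_{N+1}` joined to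
  `Γ` — how `ω′ ∈ 𝓑_0`, `ω′ ∈ 𝓑_x` are read after the surgery); and **(f1)** `not_reachable_zHat`: on `(𝓑_a)^c ∩ D′` no vertex
  of `Γ` is `p`-joined to the landing vertex `z`.

References: C. M. Newman, V. Tassion, W. Wu, *Critical percolation and the minimal spanning tree in slabs*, CPAM 70 (2017),
arXiv:1512.09107, §4.1 pp. 20–21 [NewmanTassionWu2017]; J. T. Chayes, L. Chayes, C. M. Newman, Comm. Math. Phys. 101 (1985) §3
[ChayesChayesNewman1985].
-/

noncomputable section

namespace Summit.CriticalPhenomena.PercolationContinuityZ3.Theorems.Crossing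

open Literature.Probability.Percolation Literature.Probability.LatticeModels
open Literature.Probability.Percolation.NTW17 Literature.Probability.Percolation.Invasion

/-! ## `w`: the first vertex of the plus cylinder reached by the invasion of `b` -/

section PlusEntry

variable {k : ℕ} {ω : BondConfig (slab 3 k)} {Γ : List (slab 3 k)} {n N M : ℕ} {z : slab 3 k}

/-- The vertices of an open circuit of `Ā_{n,N}` lie over `B_N`, hence in every column ball `Λ_M`, `M ≥ N`.
[cite: NewmanTassionWu2017, §4.1 (Γ_min ⊆ Ā_{n_i,2n_i})] -/
theorem mem_ballFinset_of_mem_circuit (hΓ : IsOpenCircuit k ω (slabLift k (annulus ((0 : ℤ), (0 : ℤ)) n N)) Γ)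
    (hNM : N ≤ M) {g : slab 3 k} (hg : g ∈ Γ) : g ∈ ballFinset k ((0 : ℤ), (0 : ℤ)) M := by
  rw [mem_ballFinset]
  exact slabLift_mono k ((annulus_subset_sqBox _ n N).trans (sqBox_mono _ hNM)) (hΓ.subset g hg)

/-- **The plus-entry facts (Step 2).**  If every vertex of `Γ` belongs to the invasion of `b` stopped at its break-out of `Λ_M`
(`𝓑_b`), `b ∈ Λ_M ∖ B̄₁^#(z′)`, and `z′` is a column of `Γ`, then the invasion of `b` leaves `Λ_M ∖ B̄₁^#(z′)` strictly before
it leaves `Λ_M`, through a vertex `w` of the cylinder lying in an arm column (`w̄` adjacent to `z′`), invaded at that time, and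
everything invaded up to then lies in `Λ_M`. [cite: NewmanTassionWu2017, §4.1 (proof of Lemma 4.1, Step 2: "𝓘_x^{m_i} touches B̄₁^#(z′) … w the first vertex in ∂B̄₁^#(z′) reached")] -/
theorem wHat_spec (hΓ : IsOpenCircuit k ω (slabLift k (annulus ((0 : ℤ), (0 : ℤ)) n N)) Γ) (hNM : N ≤ M)
    (hz : ∃ g ∈ Γ, planarAdj (planar k z) (planar k g)) {U : Sym2 (slab 3 k) → ℝ} {b : slab 3 k}
    (hb : b ∈ wDom k Γ z M)
    (hB : ∀ v ∈ Γ, v ∈ invasion (slabGraph 3 k) U b (exitIndex (slabGraph 3 k) U b (ballFinset k ((0 : ℤ), (0 : ℤ)) M))) :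
    exitIndex (slabGraph 3 k) U b (wDom k Γ z M) < exitIndex (slabGraph 3 k) U b (ballFinset k ((0 : ℤ), (0 : ℤ)) M) ∧
      wHat k Γ z M U b ∈ invasion (slabGraph 3 k) U b (exitIndex (slabGraph 3 k) U b (wDom k Γ z M)) ∧
      invasion (slabGraph 3 k) U b (exitIndex (slabGraph 3 k) U b (wDom k Γ z M)) ⊆ ballFinset k ((0 : ℤ), (0 : ℤ)) M ∧
      wHat k Γ z M U b ∈ plusCyl k (landCol k Γ z) ∧
      planarAdj (planar k (wHat k Γ z M U b)) (landCol k Γ z) := by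
  set G := slabGraph 3 k with hG
  set Λm := ballFinset k ((0 : ℤ), (0 : ℤ)) M with hΛm
  set W := wDom k Γ z M with hW
  have hexm := exists_not_subset_invasion_slab U b Λm
  have hexW := exists_not_subset_invasion_slab U b W
  have hbm : b ∈ Λm := wDom_subset_ballFinset Γ z M hb
  obtain ⟨g, hgΓ, hgy⟩ := (landCol_spec hz).1
  -- `g ∈ Γ` over `z′` is invaded before the break-out of `Λ_M`, and is off `W`
  obtain ⟨hIT, hsubT⟩ := invasion_exitIndex_eq_insert hbm hexm
  have hgT : g ∈ invasion G U b (exitIndex G U b Λm - 1) := by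
    have := hB g hgΓ
    rw [hIT, Finset.mem_insert] at this
    rcases this with hge | h
    · exact absurd (hge ▸ mem_ballFinset_of_mem_circuit hΓ hNM hgΓ) (exitVertex_not_mem hbm hexm)
    · exact h
  have hgW : g ∉ W := fun h => (mem_wDom_iff.1 h).2 (mem_plusCyl_of_planar_eq hgy)
  have hlt : exitIndex G U b W < exitIndex G U b Λm := by
    have h1 : exitIndex G U b W ≤ exitIndex G U b Λm - 1 := by
      by_contra hlt
      exact hgW ((exitIndex_spec G hexW).2 _ (not_le.1 hlt) hgT)
    exact lt_of_le_of_lt h1 (Nat.sub_lt (exitIndex_pos hbm hexm) one_pos)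
  have hsubW : invasion G U b (exitIndex G U b W) ⊆ Λm := (exitIndex_spec G hexm).2 _ hlt
  have hwI := exitVertex_mem_invasion hb hexW
  have hwm : wHat k Γ z M U b ∈ Λm := hsubW hwI
  have hwP : wHat k Γ z M U b ∈ plusCyl k (landCol k Γ z) := by
    by_contra hP
    exact exitVertex_not_mem hb hexW (mem_wDom_iff.2 ⟨(mem_ballFinset k).1 hwm, hP⟩)
  obtain ⟨u, hu, hadj⟩ := exists_adj_exitVertex hb hexW
  have huW : u ∈ W := (invasion_exitIndex_eq_insert hb hexW).2 hu
  have huP : u ∉ plusCyl k (landCol k Γ z) := (mem_wDom_iff.1 huW).2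
  exact ⟨hlt, hwI, hsubW, hwP, (planarAdj_of_adj_of_not_mem_plusCyl hwP huP hadj).1⟩

/-- `w̄ ∈ B_{N+1}` when `z′ ∈ B_N` (the plus lies in the unit box about its centre).
[cite: NewmanTassionWu2017, §4.1 (B̄₁^#(z′) ⊆ B̄_{2n_i+1}, repair (R1) of the lane's memo)] -/
theorem planar_mem_sqBox_succ_of_mem_plusCyl {y : ℤ × ℤ} (hy : y ∈ sqBox ((0 : ℤ), (0 : ℤ)) N) {v : slab 3 k}
    (hv : v ∈ plusCyl k y) : planar k v ∈ sqBox ((0 : ℤ), (0 : ℤ)) (N + 1) :=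
  mem_sqBox_add hy (plusCols_subset_sqBox y hv)

/-- The landing column lies over `B_N`. [cite: NewmanTassionWu2017, §4.1 (z′ ∈ Γ_min ⊆ B̄_{2n_i})] -/
theorem landCol_mem_sqBox (hΓ : IsOpenCircuit k ω (slabLift k (annulus ((0 : ℤ), (0 : ℤ)) n N)) Γ)
    (hz : ∃ g ∈ Γ, planarAdj (planar k z) (planar k g)) : landCol k Γ z ∈ sqBox ((0 : ℤ), (0 : ℤ)) N := by
  obtain ⟨g, hgΓ, hgy⟩ := (landCol_spec hz).1
  rw [← hgy]
  exact annulus_subset_sqBox _ n N (hΓ.subset g hgΓ)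

/-- **Locality of `w`.**  Two label fields agreeing off the pairs inside `B̄₁^#(z′)` have the same `w`, the same entry time and the
same invasion of `b` up to it. [cite: NewmanTassionWu2017, §4.1 (proof of Lemma 4.1: ω′ ∈ 𝓑_x)] -/
theorem wHat_congr {U U' : Sym2 (slab 3 k) → ℝ} (h : ∀ e, e ∉ plusEdges k (landCol k Γ z) → U e = U' e)
    {b : slab 3 k} (hb : b ∈ wDom k Γ z M) :
    wHat k Γ z M U' b = wHat k Γ z M U b ∧
      exitIndex (slabGraph 3 k) U' b (wDom k Γ z M) = exitIndex (slabGraph 3 k) U b (wDom k Γ z M) ∧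
      ∀ j ≤ exitIndex (slabGraph 3 k) U b (wDom k Γ z M),
        invasion (slabGraph 3 k) U b j = invasion (slabGraph 3 k) U' b j := by
  have hex := exists_not_subset_invasion_slab U b (wDom k Γ z M)
  have hagree := agree_adj_wDom_of_agree_off_plusEdges (M := M) h
  exact ⟨Rsw3.exitVertex_congr_of_agree_adj hb hex hagree, Rsw3.exitIndex_congr_of_agree_adj hex hagree,
    fun j hj => Rsw3.invasion_congr_of_agree_adj hex hagree hj⟩

end PlusEntry

/-! ## Blocked absorption at the scale: the event `D′` -/

section Blocked

variable {k : ℕ} {p : ℝ} {U : Sym2 (slab 3 k) → ℝ} {N M : ℕ}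

/-- **On `D′` the `p`-cluster of a vertex over `B_{N+1}` stays in `Λ_M`** (`N + 1 ≤ M`): an open path from `v` leaving `B̄_M`
would, followed up to its first exit, join `B̄_{N+1}` to `∂B̄_{M+1}` inside `B̄_{M+1}`.
[cite: NewmanTassionWu2017, §4.1 (proof of Lemma 4.1: "when D_{2n_i,m_i} occurs, 𝓘_0^{m_i} touching any vertex v ∈ B̄_{2n_i} implies it also contains all of C_{p_c}(v)")] -/
theorem openCluster_subset_ballFinset_of_not_mem_slabConn (hNM : N + 1 ≤ M)
    (hD : configOfLabels p U (slabGraph 3 k) ∉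
      slabConn k (sqBox ((0 : ℤ), (0 : ℤ)) (M + 1)) (sqBox ((0 : ℤ), (0 : ℤ)) (N + 1)) (sqSphere ((0 : ℤ), (0 : ℤ)) (M + 1)))
    {v : slab 3 k} (hv : planar k v ∈ sqBox ((0 : ℤ), (0 : ℤ)) (N + 1)) :
    openCluster (configOfLabels p U (slabGraph 3 k)) v ⊆ ↑(ballFinset k ((0 : ℤ), (0 : ℤ)) M) := by
  intro u hu
  rw [coe_ballFinset]
  by_contra huM
  have hvM : v ∈ slabLift k (sqBox ((0 : ℤ), (0 : ℤ)) M) := slabLift_mono k (sqBox_mono _ hNM) hv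
  have hpath := pathIn_univ_of_reachable (G := openGraph (configOfLabels p U (slabGraph 3 k))) hu
  obtain ⟨a, b, haM, hbM, -, hab, hva⟩ := hpath.exit hvM huM
  have habG : (slabGraph 3 k).Adj a b := Rsw3.openGraph_configOfLabels_le p U hab
  -- the exit pair is horizontal: a vertical neighbour of `a` lies in the column of `a`
  have hpa : planarAdj (planar k a) (planar k b) := by
    rcases (slab_adj_iff a b).1 habG with ⟨-, h⟩ | ⟨hpe, -⟩
    · exact h
    · exact absurd (by rw [mem_slabLift_iff, ← hpe]; exact (mem_slabLift_iff k _ _).1 haM) hbM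
  have hbM1 : planar k b ∈ sqBox ((0 : ℤ), (0 : ℤ)) (M + 1) :=
    mem_sqBox_add ((mem_slabLift_iff k _ _).1 haM) (mem_sqBox_one_of_planarAdj hpa)
  have hbS : planar k b ∈ sqSphere ((0 : ℤ), (0 : ℤ)) (M + 1) := by
    rw [mem_sqSphere_iff]
    refine ⟨hbM1, ?_⟩
    have hbM' : ¬ (|(planar k b).1 - 0| ≤ (M : ℤ) ∧ |(planar k b).2 - 0| ≤ (M : ℤ)) := fun h => hbM h
    push_cast
    rw [not_and_or, not_le, not_le] at hbM'
    rcases hbM' with h | h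
    · left; omega
    · right; omega
  apply hD
  refine ⟨v, hv, b, hbS, ?_⟩
  rw [mem_openConnIn_iff_pathIn]
  have hva' : PathIn (openGraph (configOfLabels p U (slabGraph 3 k))) (slabLift k (sqBox ((0 : ℤ), (0 : ℤ)) (M + 1))) v a :=
    (hva.mono Set.inter_subset_left).mono (slabLift_mono k (sqBox_mono _ (Nat.le_succ M)))
  exact hva'.tail hab hbM1

/-- **Blocked absorption at the scale.**  On `D′`, a vertex over `B_{N+1}` that belongs to the invasion of `b` stopped at its
break-out of `Λ_M` has its whole `p`-cluster inside that stopped invasion (the lane's `openCluster_subset_invasion_exitIndex`,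
repair (R0), applied with `C_p(v) ⊆ Λ_M`). [cite: NewmanTassionWu2017, §4.1 (proof of Lemma 4.1, the observation on D_{2n_i,m_i})] -/
theorem openCluster_subset_stoppedInvasion (hNM : N + 1 ≤ M)
    (hD : configOfLabels p U (slabGraph 3 k) ∉
      slabConn k (sqBox ((0 : ℤ), (0 : ℤ)) (M + 1)) (sqBox ((0 : ℤ), (0 : ℤ)) (N + 1)) (sqSphere ((0 : ℤ), (0 : ℤ)) (M + 1)))
    {b v : slab 3 k} (hvN : planar k v ∈ sqBox ((0 : ℤ), (0 : ℤ)) (N + 1))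
    (hv : v ∈ invasion (slabGraph 3 k) U b (exitIndex (slabGraph 3 k) U b (ballFinset k ((0 : ℤ), (0 : ℤ)) M))) :
    openCluster (configOfLabels p U (slabGraph 3 k)) v ⊆
      ↑(invasion (slabGraph 3 k) U b (exitIndex (slabGraph 3 k) U b (ballFinset k ((0 : ℤ), (0 : ℤ)) M))) :=
  Rsw3.openCluster_subset_invasion_exitIndex (exists_not_subset_invasion_slab U b _) hv
    (openCluster_subset_ballFinset_of_not_mem_slabConn hNM hD hvN)

/-- **Gluing read-out: `V(Γ) ⊆ 𝓘_b^M` from one joined vertex.**  On `D′`, if a vertex `v` over `B_{N+1}` of the stopped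
invasion `𝓘_b^M` is `p`-joined to a vertex of a `p`-open circuit `Γ`, then every vertex of `Γ` lies in `𝓘_b^M` (this is how
`ω′ ∈ 𝓑_0` and `ω′ ∈ 𝓑_x` are obtained after the surgery, with `v = z`, resp. `v = w`).
[cite: NewmanTassionWu2017, §4.1 (proof of Lemma 4.1: "By construction, ω′ ∈ 𝓑_0^{m_i} ∩ 𝓑_x^{m_i} ∩ 𝒴_A")] -/
theorem forall_mem_stoppedInvasion_of_reachable (hNM : N + 1 ≤ M)
    (hD : configOfLabels p U (slabGraph 3 k) ∉
      slabConn k (sqBox ((0 : ℤ), (0 : ℤ)) (M + 1)) (sqBox ((0 : ℤ), (0 : ℤ)) (N + 1)) (sqSphere ((0 : ℤ), (0 : ℤ)) (M + 1)))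
    {Γ : List (slab 3 k)} {A : Set (slab 3 k)} (hΓ : IsOpenCircuit k (configOfLabels p U (slabGraph 3 k)) A Γ)
    {b v : slab 3 k} (hvN : planar k v ∈ sqBox ((0 : ℤ), (0 : ℤ)) (N + 1))
    (hv : v ∈ invasion (slabGraph 3 k) U b (exitIndex (slabGraph 3 k) U b (ballFinset k ((0 : ℤ), (0 : ℤ)) M)))
    {g : slab 3 k} (hg : g ∈ Γ) (hvg : (openGraph (configOfLabels p U (slabGraph 3 k))).Reachable v g) :
    ∀ g' ∈ Γ, g' ∈ invasion (slabGraph 3 k) U b (exitIndex (slabGraph 3 k) U b (ballFinset k ((0 : ℤ), (0 : ℤ)) M)) :=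
  fun _ hg' => Finset.mem_coe.1 (openCluster_subset_stoppedInvasion hNM hD hvN hv (hvg.trans (hΓ.reachable_of_mem hg hg')))

/-- **(f1): on `(𝓑_a)^c ∩ D′` the landing vertex is not joined to `Γ`.**  With `Γ` a surrounding `p`-open circuit of
`Ā_{n,N}`, `a ∈ R ∖ ∂R`, `N + 1 ≤ M`: if some vertex of `Γ` is NOT in `𝓘_a^M`, then no vertex of `Γ` is `p`-joined to
`z = zHat` ("Otherwise, by the observation in Section 2, we would have `Γ_min(ω) ⊂ 𝓘_0^{m_i}(ω)`").
[cite: NewmanTassionWu2017, §4.1 (proof of Lemma 4.1, (f1): z(ω) ∉ C_{p_c}(Γ_min(ω)))] -/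
theorem not_reachable_zHat {Γ : List (slab 3 k)} {n : ℕ} (hNM : N + 1 ≤ M)
    (hΓ : IsOpenCircuit k (configOfLabels p U (slabGraph 3 k)) (slabLift k (annulus ((0 : ℤ), (0 : ℤ)) n N)) Γ)
    (hs : Surrounds k ((0 : ℤ), (0 : ℤ)) Γ)
    (hD : configOfLabels p U (slabGraph 3 k) ∉
      slabConn k (sqBox ((0 : ℤ), (0 : ℤ)) (M + 1)) (sqBox ((0 : ℤ), (0 : ℤ)) (N + 1)) (sqSphere ((0 : ℤ), (0 : ℤ)) (M + 1)))
    {a : slab 3 k} (ha : a ∈ insideFin k Γ N)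
    (hnotB : ¬ ∀ g ∈ Γ, g ∈ invasion (slabGraph 3 k) U a (exitIndex (slabGraph 3 k) U a (ballFinset k ((0 : ℤ), (0 : ℤ)) M))) :
    ∀ g ∈ Γ, ¬ (openGraph (configOfLabels p U (slabGraph 3 k))).Reachable (zHat k Γ N U a) g := by
  intro g hg hzg
  have hω : configOfLabels p U (slabGraph 3 k) ⊆ (slabGraph 3 k).edgeSet := fun _ h => h.1
  exact hnotB (forall_mem_stoppedInvasion_of_reachable hNM hD hΓ
    (sqBox_mono _ (Nat.le_succ N) (planar_zHat_mem_sqBox hω hΓ hs ha))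
    (zHat_mem_stoppedInvasion hω hΓ hs ha ((Nat.le_succ N).trans hNM)) hg hzg)

end Blocked

end Summit.CriticalPhenomena.PercolationContinuityZ3.Theorems.Crossing
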